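import Literature.MathematicalPhysics.QuantumFieldTheory.Balaban1983to89.B4Eq19LatticeDirichletReplacement
import Literature.MathematicalPhysics.QuantumFieldTheory.Balaban1983to89.B4Eq19LatticeHarmonicDecay
import Literature.MathematicalPhysics.QuantumFieldTheory.Balaban1983to89.B4Eq19CampanatoIteration
import Literature.MathematicalPhysics.QuantumFieldTheory.Balaban1983to89.B4Eq19LatticePoincareMorrey

/-!
# `Balaban1983to89.B4Eq19LatticeInteriorHolder` — T. Bałaban, *Propagators and renormalization transformations for lattice gauge theories. II*,
# Commun. Math. Phys. **96** (1984) 223–250 [Balaban1984PropagatorsII] (1.9) p. 226: **THE INTERIOR `C^{1∕2}` ESTIMATE FOR THE MASSIVE LATTICE EQUATION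
# `(−Δ + K⁻²)u = ∂*g` ON `ℤ^d`, UNIFORM IN THE SCALE `K`** — if `|u| ≤ M_u` and `|g| ≤ m` on `Q_{4K}(a)` and the equation holds there, then for `x′ ∈ Q_{ρ₀}(a)`,
# `1 ≤ ρ₀ ≤ K`: `|u(x′) − u(a)| ≤ C_d (M_u + K m) √(ρ₀∕K)` — the assembled Campanato road ([Giaquinta1984] Ch. III §2 Thm 2.2 with §1 Thm 1.2): Caccioppoli
# (`B4Eq19LatticeCaccioppoli`) → harmonic replacement (`B4Eq19LatticeDirichletReplacement`) → energy decay (`B4Eq19LatticeHarmonicDecay`) → iteration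
# (`B4Eq19CampanatoIteration`) → Morrey (`B4Eq19LatticePoincareMorrey`).  This is the `ℤ^d` core of the LOCAL η-scale Hölder estimate `Hloc` of
# `B9Eq343FlatWindowLetterOfLocalHolder` (the torus transfer is the sequel).

statement-level skeleton of published theorems with citation tags; proofs where landed; nothing here is a claim about the Yang–Mills mass gap

CITATION HEADER (lean-in-tree rule).  Audit cell `pub-balaban`, sub-cell `t4`, BINDER row NE9; filed by NE9 crux-team LEAF PROVER 01
(`b2b-balaban-t4-ne9-formalise-leaf-01`, gen 94; bears_on: R4/N22).  CONTENT: [folklore] discrete elliptic regularity assembled from the five predecessor files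
(continuum: [Giaquinta1984] Ch. III Thm 2.2 p. 78 ∕ Thm 1.2 p. 70).  Nothing of [Balaban1984PropagatorsII] is asserted.

WHAT IS PROVED (sorry-free; proof lane — 0 `def`).
* **`campanato_step`** — for `κ > 0`, `0 ≤ ρ ≤ r`, the equation on `Q_{r+1}(z)` and `|g| ≤ m` on `Q_{r+2}(z)`:
  `gradSq u (Q_ρ) ≤ 4A_d ((ρ+1)∕(r+1))^d gradSq u (Q_r) + (4A_d+2)·d·5^d·m²·(r+1)^d` (replacement + harmonic decay).
* `top_scale_bound` (Caccioppoli at scale `K`, margin `K−2`), `campanato_hypothesis` (integer radii → the real-variable hypothesis of the iteration lemma);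
  **`morrey_bound`** — for `K ≥ 3`, a centre `z ∈ Q_K(a)`, bounds on `Q_{4K}(a)`: `gradSq u (Q_ρ(z)) ≤ N·(ρ+1)^{d−1}` for `0 ≤ ρ ≤ 2K` with
  `N = C′_d (M_u + K m)²∕K`.
* **`exists_interior_holder_const`** — THE ESTIMATE: `∃ C_d ≥ 0, ∀ K ≥ 3, …, |u(x′) − u(a)| ≤ C_d (M_u + K m) √(ρ₀∕K)`.
HONEST SCOPE.  [folklore] lattice analysis on `ℤ^d`; NOT summit progress (cell pub-balaban: NE9 NOT PRINTED ∕ NOT PROVED; spine PROVED 0∕9; finite T⁴ — NOT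
infinite volume, NOT mass gap, NOT BetaPertH, NOT Clay).  NEW file importing the four `B4Eq19*` predecessors.  Net new unproved facts: 0.
-/

noncomputable section

open scoped BigOperators
open Finset

namespace Literature.MathematicalPhysics.QuantumFieldTheory.Balaban1983to89.B4Eq19LatticeInteriorHolder

open B4Eq19LatticeOperators B4Eq19LatticeCaccioppoli B4Eq19LatticeDirichletReplacement B4Eq19LatticeHarmonicDecay B4Eq19CampanatoIteration
  B4Eq19LatticePoincareMorrey

variable {d : ℕ}

/-! ## §1 One Campanato step: replacement + harmonic decay -/

/-- A box sum of squares of a bond function bounded by `m` on the box: `Σ_{y∈Q_s(z)} Σ_μ g(y,μ)² ≤ d (2s+1)^d m²`. [folklore]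
[cite: Giaquinta1984, Ch. III §2 p.79] -/
theorem sum_sq_le_of_bound {z : Zd d} {s : ℤ} (hs : 0 ≤ s) (g : Zd d → Fin d → ℝ) {m : ℝ}
    (hg : ∀ y ∈ box z s, ∀ μ, |g y μ| ≤ m) : ∑ y ∈ box z s, ∑ μ, g y μ ^ 2 ≤ d * ((2 * s + 1 : ℤ) : ℝ) ^ d * m ^ 2 := by
  calc ∑ y ∈ box z s, ∑ μ, g y μ ^ 2 ≤ ∑ y ∈ box z s, ∑ μ : Fin d, m ^ 2 := Finset.sum_le_sum fun y hy => Finset.sum_le_sum fun μ _ => by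
          have := hg y hy μ; rw [← sq_abs]; exact pow_le_pow_left₀ (abs_nonneg _) this 2
    _ = (box z s).card * (d * m ^ 2) := by rw [Finset.sum_const, nsmul_eq_mul, Finset.sum_const, Finset.card_univ, Fintype.card_fin, nsmul_eq_mul]
    _ = d * ((2 * s + 1 : ℤ) : ℝ) ^ d * m ^ 2 := by rw [card_box z hs]; ring

/-- A box sum of squares of a site function bounded by `M`: `Σ_{y∈Q_s(z)} u(y)² ≤ (2s+1)^d M²`. [folklore] [cite: Giaquinta1984, Ch. III §2 p.79] -/
theorem sum_sq_le_of_bound' {z : Zd d} {s : ℤ} (hs : 0 ≤ s) (u : Zd d → ℝ) {M : ℝ}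
    (hu : ∀ y ∈ box z s, |u y| ≤ M) : ∑ y ∈ box z s, u y ^ 2 ≤ ((2 * s + 1 : ℤ) : ℝ) ^ d * M ^ 2 := by
  calc ∑ y ∈ box z s, u y ^ 2 ≤ ∑ y ∈ box z s, M ^ 2 := Finset.sum_le_sum fun y hy => by
          have := hu y hy; rw [← sq_abs]; exact pow_le_pow_left₀ (abs_nonneg _) this 2
    _ = ((2 * s + 1 : ℤ) : ℝ) ^ d * M ^ 2 := by rw [Finset.sum_const, nsmul_eq_mul, card_box z hs]

/-- **ONE CAMPANATO STEP.**  For `κ > 0`, integers `0 ≤ ρ ≤ r`, the equation `(−Δ+κ)u = ∂*g` on `Q_{r+1}(z)` and `|g| ≤ m` on `Q_{r+2}(z)`: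
`gradSq u (Q_ρ(z)) ≤ 4A_d ((ρ+1)∕(r+1))^d gradSq u (Q_r(z)) + (4A_d + 2)·(d·5^d·m²)·(r+1)^d`, `A_d = 2^d(1+56d)^d(8(d+1))^{d+1}` (write `u = h + w` on
`Q_{r+1}(z)` by `exists_harmonic_replacement`; `harmonic_decay` for `h`; `gradSq w ≤ Σ_{Q_{r+2}} |g|² ≤ d(2r+5)^d m² ≤ d 5^d (r+1)^d m²`).
[folklore] [cite: Giaquinta1984, Ch. III §2 Thm 2.2 pp.78–79] -/
theorem campanato_step {κ : ℝ} (hκ : 0 < κ) (u : Zd d → ℝ) (g : Zd d → Fin d → ℝ) (z : Zd d) {ρ r : ℤ} (hρ : 0 ≤ ρ) (hρr : ρ ≤ r)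
    {m : ℝ} (hEq : ∀ y ∈ box z (r + 1), lop κ u y = dvg g y) (hg : ∀ y ∈ box z (r + 2), ∀ μ, |g y μ| ≤ m) :
    gradSq u (box z ρ) ≤ 4 * ((2 : ℝ) ^ d * (1 + 56 * d) ^ d * (8 * ((d : ℝ) + 1)) ^ (d + 1)) * (((ρ : ℝ) + 1) / ((r : ℝ) + 1)) ^ d * gradSq u (box z r) +
      (4 * ((2 : ℝ) ^ d * (1 + 56 * d) ^ d * (8 * ((d : ℝ) + 1)) ^ (d + 1)) + 2) * (d * 5 ^ d * m ^ 2) * ((r : ℝ) + 1) ^ d := by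
  set A : ℝ := (2 : ℝ) ^ d * (1 + 56 * d) ^ d * (8 * ((d : ℝ) + 1)) ^ (d + 1) with hA
  have hA0 : 0 ≤ A := by positivity
  have hr : 0 ≤ r := hρ.trans hρr
  have hρR : (0 : ℝ) ≤ ρ := by exact_mod_cast hρ
  have hrR : (ρ : ℝ) ≤ r := by exact_mod_cast hρr
  have hq0 : 0 ≤ ((ρ : ℝ) + 1) / ((r : ℝ) + 1) := by positivity
  have hq1 : ((ρ : ℝ) + 1) / ((r : ℝ) + 1) ≤ 1 := by rw [div_le_one (by linarith)]; linarith
  have hqd1 : (((ρ : ℝ) + 1) / ((r : ℝ) + 1)) ^ d ≤ 1 := pow_le_one₀ hq0 hq1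
  -- harmonic replacement on `Q_{r+1}(z)`
  obtain ⟨h, w, hsum, hw0, hh, hwE⟩ := exists_harmonic_replacement hκ u g z (r + 1) hEq
  set G : ℝ := ∑ y ∈ box z (r + 1 + 1), ∑ μ, g y μ ^ 2 with hG
  have hG0 : 0 ≤ G := Finset.sum_nonneg fun _ _ => Finset.sum_nonneg fun _ _ => sq_nonneg _
  have hGm : G ≤ d * 5 ^ d * m ^ 2 * ((r : ℝ) + 1) ^ d := by
    have h1 := sum_sq_le_of_bound (z := z) (s := r + 2) (by linarith) g (fun y hy μ => hg y hy μ)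
    rw [show r + 1 + 1 = r + 2 by ring] at hG
    rw [hG]
    refine h1.trans ?_
    have h2 : ((2 * (r + 2) + 1 : ℤ) : ℝ) ^ d ≤ (5 * ((r : ℝ) + 1)) ^ d := pow_le_pow_left₀ (by push_cast; linarith) (by push_cast; linarith) d
    rw [mul_pow] at h2
    have hd0 : (0 : ℝ) ≤ d := Nat.cast_nonneg d
    nlinarith [sq_nonneg m, mul_nonneg hd0 (sq_nonneg m)]
  -- `u = h + w`, `h = u − w`
  have hu_eq : u = fun y => h y + w y := funext hsum
  have hh_eq : h = fun y => u y - w y := by funext y; rw [hsum y]; ring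
  have hE1 : gradSq u (box z ρ) ≤ 2 * gradSq h (box z ρ) + 2 * gradSq w (box z ρ) := by
    rw [hu_eq]; exact gradSq_add_le h w _
  have hE2 : gradSq h (box z r) ≤ 2 * gradSq u (box z r) + 2 * gradSq w (box z r) := by
    rw [hh_eq]; exact gradSq_sub_le u w _
  -- decay for `h` (harmonic on `Q_{r+1}`)
  have hdec := harmonic_decay hκ.le hρ hρr h hh
  rw [← hA] at hdec
  have hw1 := hwE (box z ρ)
  have hw2 := hwE (box z r)
  have hEu0 : 0 ≤ gradSq u (box z r) := gradSq_nonneg _ _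
  -- assemble
  calc gradSq u (box z ρ) ≤ 2 * gradSq h (box z ρ) + 2 * gradSq w (box z ρ) := hE1
    _ ≤ 2 * (A * (((ρ : ℝ) + 1) / ((r : ℝ) + 1)) ^ d * gradSq h (box z r)) + 2 * G := by
        have := mul_le_mul_of_nonneg_left hdec (by norm_num : (0:ℝ) ≤ 2); linarith
    _ ≤ 2 * (A * (((ρ : ℝ) + 1) / ((r : ℝ) + 1)) ^ d * (2 * gradSq u (box z r) + 2 * G)) + 2 * G := by
        have h3 : gradSq h (box z r) ≤ 2 * gradSq u (box z r) + 2 * G := by linarith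
        have := mul_le_mul_of_nonneg_left h3 (by positivity : (0:ℝ) ≤ A * (((ρ : ℝ) + 1) / ((r : ℝ) + 1)) ^ d)
        linarith
    _ = 4 * A * (((ρ : ℝ) + 1) / ((r : ℝ) + 1)) ^ d * gradSq u (box z r) + (4 * A * (((ρ : ℝ) + 1) / ((r : ℝ) + 1)) ^ d + 2) * G := by ring
    _ ≤ 4 * A * (((ρ : ℝ) + 1) / ((r : ℝ) + 1)) ^ d * gradSq u (box z r) + (4 * A + 2) * G := by
        have : 4 * A * (((ρ : ℝ) + 1) / ((r : ℝ) + 1)) ^ d ≤ 4 * A := by nlinarith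
        nlinarith
    _ ≤ 4 * A * (((ρ : ℝ) + 1) / ((r : ℝ) + 1)) ^ d * gradSq u (box z r) + (4 * A + 2) * (d * 5 ^ d * m ^ 2 * ((r : ℝ) + 1) ^ d) := by
        have := mul_le_mul_of_nonneg_left hGm (by positivity : (0:ℝ) ≤ 4 * A + 2); linarith
    _ = 4 * A * (((ρ : ℝ) + 1) / ((r : ℝ) + 1)) ^ d * gradSq u (box z r) + (4 * A + 2) * (d * 5 ^ d * m ^ 2) * ((r : ℝ) + 1) ^ d := by ring

/-! ## §2 The Morrey bound at one centre -/

/-- **The top scale**: for `K ≥ 3`, a centre `z ∈ Q_K(a)`, the equation `(−Δ+K⁻²)u = ∂*g` and the bounds `|u| ≤ M_u`, `|g| ≤ m` on `Q_{4K}(a)`: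
`gradSq u (Q_{2K}(z)) ≤ 126 d 7^d K^{d−2} M_u² + 4 d 6^d K^{d−2} (K m)²` (Caccioppoli with margin `K − 2 ≥ K∕3`). [folklore]
[cite: Giaquinta1984, Ch. III §2 (2.4) p.77] -/
theorem top_scale_bound {K : ℕ} (hK : 3 ≤ K) (u : Zd d → ℝ) (g : Zd d → Fin d → ℝ) (a : Zd d) {Mu m : ℝ}
    (hEq : ∀ y ∈ box a (4 * K), lop (1 / (K : ℝ) ^ 2) u y = dvg g y)
    (hu : ∀ y ∈ box a (4 * K), |u y| ≤ Mu) (hg : ∀ y ∈ box a (4 * K), ∀ μ, |g y μ| ≤ m) {z : Zd d} (hz : z ∈ box a K) :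
    gradSq u (box z (2 * K)) ≤ (126 * d * 7 ^ d) * ((K : ℝ) ^ d / (K : ℝ) ^ 2) * Mu ^ 2 + (4 * d * 6 ^ d) * ((K : ℝ) ^ d / (K : ℝ) ^ 2) * ((K : ℝ) * m) ^ 2 := by
  have hd0 : (0 : ℝ) ≤ d := Nat.cast_nonneg d
  have hK3 : (3 : ℝ) ≤ K := by exact_mod_cast hK
  have hK0 : (0 : ℝ) < K := by linarith
  have hKZ : (3 : ℤ) ≤ K := by exact_mod_cast hK
  have hκ0 : (0 : ℝ) ≤ 1 / (K : ℝ) ^ 2 := by positivity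
  have hzbox : ∀ s : ℤ, box z s ⊆ box a (s + K) := fun s => box_subset_box fun i => by
    have := (mem_box.1 hz) i; linarith
  have hs : (1 : ℤ) ≤ (K : ℤ) - 2 := by linarith
  have hC := caccioppoli hκ0 u g z (ρ := 2 * (K : ℤ)) (s := (K : ℤ) - 2) (by positivity) hs
    (fun y hy => hEq y (box_mono a (by linarith) (hzbox _ hy)))
  have hU := sum_sq_le_of_bound' (z := z) (s := 2 * (K : ℤ) + ((K : ℤ) - 2) + 2) (by linarith) u
    (fun y hy => hu y (box_mono a (by linarith) (hzbox _ hy)))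
  have hGs := sum_sq_le_of_bound (z := z) (s := 2 * (K : ℤ) + ((K : ℤ) - 2) + 1) (by linarith) g
    (fun y hy μ => hg y (box_mono a (by linarith) (hzbox _ hy)) μ)
  have e2 : ((2 * (2 * (K : ℤ) + ((K : ℤ) - 2) + 2) + 1 : ℤ) : ℝ) = 6 * (K : ℝ) + 1 := by push_cast; ring
  have e3 : ((2 * (2 * (K : ℤ) + ((K : ℤ) - 2) + 1) + 1 : ℤ) : ℝ) = 6 * (K : ℝ) - 1 := by push_cast; ring
  have e4 : (((K : ℤ) - 2 : ℤ) : ℝ) = (K : ℝ) - 2 := by push_cast; ring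
  rw [e2] at hU
  rw [e3] at hGs
  rw [e4] at hC
  have hU0 : 0 ≤ ∑ y ∈ box z (2 * K + ((K : ℤ) - 2) + 2), u y ^ 2 := Finset.sum_nonneg fun _ _ => sq_nonneg _
  have hMu2 : 0 ≤ Mu ^ 2 := sq_nonneg _
  -- `14d/(K-2)² (6K+1)^d ≤ 126 d 7^d K^d/K²`
  have i0 : (K : ℝ) ^ 2 ≤ 9 * ((K : ℝ) - 2) ^ 2 := by
    have h3 : (K : ℝ) ≤ 3 * ((K : ℝ) - 2) := by linarith
    calc (K : ℝ) ^ 2 ≤ (3 * ((K : ℝ) - 2)) ^ 2 := pow_le_pow_left₀ hK0.le h3 2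
      _ = 9 * ((K : ℝ) - 2) ^ 2 := by ring
  have i1 : 14 * (d : ℝ) / ((K : ℝ) - 2) ^ 2 ≤ 126 * d / (K : ℝ) ^ 2 := by
    have hK2' : (0 : ℝ) < (K : ℝ) - 2 := by linarith
    have hK2pos : 0 < ((K : ℝ) - 2) ^ 2 := by positivity
    rw [div_le_div_iff₀ hK2pos (by positivity)]
    calc 14 * (d : ℝ) * (K : ℝ) ^ 2 ≤ 14 * (d : ℝ) * (9 * ((K : ℝ) - 2) ^ 2) := mul_le_mul_of_nonneg_left i0 (by positivity)
      _ = 126 * d * ((K : ℝ) - 2) ^ 2 := by ring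
  have i2 : (6 * (K : ℝ) + 1) ^ d ≤ 7 ^ d * (K : ℝ) ^ d := by
    rw [← mul_pow]; exact pow_le_pow_left₀ (by positivity) (by linarith) d
  have i3 : (6 * (K : ℝ) - 1) ^ d ≤ 6 ^ d * (K : ℝ) ^ d := by
    rw [← mul_pow]; exact pow_le_pow_left₀ (by linarith) (by linarith) d
  have h1 : 14 * d / ((K : ℝ) - 2) ^ 2 * ((6 * (K : ℝ) + 1) ^ d * Mu ^ 2) ≤ (126 * d * 7 ^ d) * ((K : ℝ) ^ d / (K : ℝ) ^ 2) * Mu ^ 2 := by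
    calc 14 * d / ((K : ℝ) - 2) ^ 2 * ((6 * (K : ℝ) + 1) ^ d * Mu ^ 2) ≤ 126 * d / (K : ℝ) ^ 2 * ((7 : ℝ) ^ d * (K : ℝ) ^ d * Mu ^ 2) :=
          mul_le_mul i1 (mul_le_mul_of_nonneg_right i2 hMu2) (by positivity) (by positivity)
      _ = (126 * d * 7 ^ d) * ((K : ℝ) ^ d / (K : ℝ) ^ 2) * Mu ^ 2 := by ring
  have h2 : 4 * (d * (6 * (K : ℝ) - 1) ^ d * m ^ 2) ≤ (4 * d * 6 ^ d) * ((K : ℝ) ^ d / (K : ℝ) ^ 2) * ((K : ℝ) * m) ^ 2 := by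
    have e : (4 * d * 6 ^ d) * ((K : ℝ) ^ d / (K : ℝ) ^ 2) * ((K : ℝ) * m) ^ 2 = 4 * (d * ((6 : ℝ) ^ d * (K : ℝ) ^ d) * m ^ 2) := by
      field_simp
    rw [e]
    have t := mul_le_mul_of_nonneg_right i3 (sq_nonneg m)
    have t2 := mul_le_mul_of_nonneg_left t hd0
    linarith
  calc gradSq u (box z (2 * K)) ≤ 14 * d / ((K : ℝ) - 2) ^ 2 * ∑ y ∈ box z (2 * K + ((K : ℤ) - 2) + 2), u y ^ 2 +
        4 * ∑ y ∈ box z (2 * K + ((K : ℤ) - 2) + 1), ∑ μ, g y μ ^ 2 := hC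
    _ ≤ 14 * d / ((K : ℝ) - 2) ^ 2 * ((6 * (K : ℝ) + 1) ^ d * Mu ^ 2) + 4 * (d * (6 * (K : ℝ) - 1) ^ d * m ^ 2) :=
        add_le_add (mul_le_mul_of_nonneg_left hU (by positivity)) (mul_le_mul_of_nonneg_left hGs (by norm_num))
    _ ≤ (126 * d * 7 ^ d) * ((K : ℝ) ^ d / (K : ℝ) ^ 2) * Mu ^ 2 + (4 * d * 6 ^ d) * ((K : ℝ) ^ d / (K : ℝ) ^ 2) * ((K : ℝ) * m) ^ 2 := add_le_add h1 h2

/-- **The real-variable Campanato hypothesis** for `ψ(t) = gradSq u (Q_{⌊t⌋−1}(z))`: from the integer-radius step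
`gradSq u (Q_ρ) ≤ 4A₀((ρ+1)∕(r+1))^d gradSq u (Q_r) + B (r+1)^d` (`0 ≤ ρ ≤ r ≤ 2K`) to `ψ(P) ≤ (4·2^d A₀)(P∕R)^d ψ(R) + B R^d` (`1 ≤ P ≤ R ≤ 2K+1`;
`⌊P⌋∕⌊R⌋ ≤ 2P∕R`, `⌊R⌋ ≤ R`). [folklore] [cite: Giaquinta1984, Ch. III Lemma 2.1 p.86] -/
theorem campanato_hypothesis (u : Zd d → ℝ) (z : Zd d) {K : ℕ} {A₀ B : ℝ} (hA₀ : 0 ≤ A₀) (hB : 0 ≤ B)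
    (hstep : ∀ ρ r : ℤ, 0 ≤ ρ → ρ ≤ r → r ≤ 2 * K →
      gradSq u (box z ρ) ≤ 4 * A₀ * (((ρ : ℝ) + 1) / ((r : ℝ) + 1)) ^ d * gradSq u (box z r) + B * ((r : ℝ) + 1) ^ d) :
    ∀ P R : ℝ, 1 ≤ P → P ≤ R → R ≤ 2 * (K : ℝ) + 1 →
      gradSq u (box z (⌊P⌋ - 1)) ≤ (4 * 2 ^ d * A₀) * (P / R) ^ d * gradSq u (box z (⌊R⌋ - 1)) + B * R ^ d := by
  intro P R hP hPR hR
  have hfP : (1 : ℤ) ≤ ⌊P⌋ := by have := Int.floor_le_floor hP; rwa [Int.floor_one] at this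
  have hfPR : ⌊P⌋ ≤ ⌊R⌋ := Int.floor_le_floor hPR
  have hfR : ⌊R⌋ ≤ 2 * (K : ℤ) + 1 := by
    have := Int.floor_le_floor hR
    rwa [show (2 * (K : ℝ) + 1) = ((2 * (K : ℤ) + 1 : ℤ) : ℝ) by push_cast; ring, Int.floor_intCast] at this
  have h := hstep (⌊P⌋ - 1) (⌊R⌋ - 1) (by linarith) (by linarith) (by linarith)
  have e1 : (((⌊P⌋ - 1 : ℤ) : ℝ) + 1) = (⌊P⌋ : ℝ) := by push_cast; ring
  have e2 : (((⌊R⌋ - 1 : ℤ) : ℝ) + 1) = (⌊R⌋ : ℝ) := by push_cast; ring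
  rw [e1, e2] at h
  have hfR1 : (1 : ℝ) ≤ (⌊R⌋ : ℝ) := by have : (1:ℤ) ≤ ⌊R⌋ := hfP.trans hfPR; exact_mod_cast this
  have hfRpos : (0 : ℝ) < (⌊R⌋ : ℝ) := by linarith
  have hR0 : 0 < R := by linarith
  have hratio : (⌊P⌋ : ℝ) / (⌊R⌋ : ℝ) ≤ 2 * (P / R) := by
    rw [div_le_iff₀ hfRpos]
    have h2 : R < (⌊R⌋ : ℝ) + 1 := Int.lt_floor_add_one R
    calc (⌊P⌋ : ℝ) ≤ P := Int.floor_le P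
      _ = (P / R) * R := by field_simp
      _ ≤ (P / R) * (2 * (⌊R⌋ : ℝ)) := mul_le_mul_of_nonneg_left (by linarith) (by positivity)
      _ = 2 * (P / R) * (⌊R⌋ : ℝ) := by ring
  have hratio_d : ((⌊P⌋ : ℝ) / (⌊R⌋ : ℝ)) ^ d ≤ 2 ^ d * (P / R) ^ d := by
    rw [← mul_pow]; exact pow_le_pow_left₀ (by positivity) hratio d
  have hRd : (⌊R⌋ : ℝ) ^ d ≤ R ^ d := pow_le_pow_left₀ hfRpos.le (Int.floor_le R) d
  have hψR0 : 0 ≤ gradSq u (box z (⌊R⌋ - 1)) := gradSq_nonneg _ _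
  calc gradSq u (box z (⌊P⌋ - 1)) ≤ 4 * A₀ * ((⌊P⌋ : ℝ) / (⌊R⌋ : ℝ)) ^ d * gradSq u (box z (⌊R⌋ - 1)) + B * (⌊R⌋ : ℝ) ^ d := h
    _ ≤ 4 * A₀ * (2 ^ d * (P / R) ^ d) * gradSq u (box z (⌊R⌋ - 1)) + B * R ^ d := by
        have t1 := mul_le_mul_of_nonneg_left hratio_d (by positivity : (0:ℝ) ≤ 4 * A₀)
        have t2 := mul_le_mul_of_nonneg_right t1 hψR0
        have t3 := mul_le_mul_of_nonneg_left hRd hB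
        exact add_le_add t2 t3
    _ = (4 * 2 ^ d * A₀) * (P / R) ^ d * gradSq u (box z (⌊R⌋ - 1)) + B * R ^ d := by ring

/-- **THE MORREY BOUND AT A CENTRE `z ∈ Q_K(a)`.**  Let `d ≥ 1`, `K ≥ 3`, `κ = 1∕K²`, the equation on `Q_{4K}(a)`, `|u| ≤ M_u` and `|g| ≤ m` on `Q_{4K}(a)`,
`0 ≤ M_u`, `0 ≤ m`.  Then for `0 ≤ ρ ≤ 2K`: `gradSq u (Q_ρ(z)) ≤ N (ρ+1)^{d−1}` with `N = C′_d (M_u + K m)² ∕ K`,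
`C′_d = 2(2·4·2^d A_d)^{2(d−1)} (126 d 7^d + 4 d 6^d + (4A_d+2) d 15^d)` (Campanato's iteration lemma for `ψ(t) = gradSq u (Q_{⌊t⌋−1}(z))` on
`[1, 2K+1]`, then `top_scale_bound`). [folklore] [cite: Giaquinta1984, Ch. III §2 Thm 2.2 p.78, Lemma 2.1 p.86] -/
theorem morrey_bound (hd : 1 ≤ d) {K : ℕ} (hK : 3 ≤ K) (u : Zd d → ℝ) (g : Zd d → Fin d → ℝ) (a : Zd d) {Mu m : ℝ} (hMu : 0 ≤ Mu) (hm : 0 ≤ m)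
    (hEq : ∀ y ∈ box a (4 * K), lop (1 / (K : ℝ) ^ 2) u y = dvg g y)
    (hu : ∀ y ∈ box a (4 * K), |u y| ≤ Mu) (hg : ∀ y ∈ box a (4 * K), ∀ μ, |g y μ| ≤ m)
    {z : Zd d} (hz : z ∈ box a K) :
    ∀ ρ : ℤ, 0 ≤ ρ → ρ ≤ 2 * K →
      gradSq u (box z ρ) ≤ (2 * (2 * (4 * 2 ^ d * ((2 : ℝ) ^ d * (1 + 56 * d) ^ d * (8 * ((d : ℝ) + 1)) ^ (d + 1)))) ^ (2 * (d - 1)) *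
        (126 * d * 7 ^ d + 4 * d * 6 ^ d + (4 * ((2 : ℝ) ^ d * (1 + 56 * d) ^ d * (8 * ((d : ℝ) + 1)) ^ (d + 1)) + 2) * d * 15 ^ d) *
        (Mu + K * m) ^ 2 / K) * ((ρ : ℝ) + 1) ^ (d - 1) := by
  set A₀ : ℝ := (2 : ℝ) ^ d * (1 + 56 * d) ^ d * (8 * ((d : ℝ) + 1)) ^ (d + 1) with hA₀
  have hA₀1 : 1 ≤ A₀ := by
    rw [hA₀]
    have h1 : (1 : ℝ) ≤ 2 ^ d := one_le_pow₀ (by norm_num)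
    have h2 : (1 : ℝ) ≤ (1 + 56 * d) ^ d := one_le_pow₀ (by have := Nat.cast_nonneg (α := ℝ) d; linarith)
    have h3 : (1 : ℝ) ≤ (8 * ((d : ℝ) + 1)) ^ (d + 1) := one_le_pow₀ (by have := Nat.cast_nonneg (α := ℝ) d; linarith)
    exact one_le_mul_of_one_le_of_one_le (one_le_mul_of_one_le_of_one_le h1 h2) h3
  have hA₀0 : 0 ≤ A₀ := by linarith
  have hd0 : (0 : ℝ) ≤ d := Nat.cast_nonneg d
  have hK3 : (3 : ℝ) ≤ K := by exact_mod_cast hK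
  have hK0 : (0 : ℝ) < K := by linarith
  have hκ0 : (0 : ℝ) < 1 / (K : ℝ) ^ 2 := by positivity
  -- geometry: `Q_s(z) ⊆ Q_{s+K}(a)`
  have hzbox : ∀ s : ℤ, box z s ⊆ box a (s + K) := fun s => box_subset_box fun i => by
    have := (mem_box.1 hz) i; linarith
  -- the Campanato hypothesis at integer radii `0 ≤ ρ ≤ r ≤ 2K`
  set B : ℝ := (4 * A₀ + 2) * (d * 5 ^ d * m ^ 2) with hB
  have hB0 : 0 ≤ B := by positivity
  have hstep : ∀ ρ r : ℤ, 0 ≤ ρ → ρ ≤ r → r ≤ 2 * K →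
      gradSq u (box z ρ) ≤ 4 * A₀ * (((ρ : ℝ) + 1) / ((r : ℝ) + 1)) ^ d * gradSq u (box z r) + B * ((r : ℝ) + 1) ^ d := by
    intro ρ r hρ hρr hr
    have h := campanato_step hκ0 u g z hρ hρr (fun y hy => hEq y (box_mono a (by linarith) (hzbox _ hy)))
      (fun y hy μ => hg y (box_mono a (by linarith) (hzbox _ hy)) μ)
    rw [← hA₀, ← hB] at h
    exact h
  -- Campanato's iteration lemma for `ψ(t) = gradSq u (Q_{⌊t⌋-1}(z))` on `[1, 2K+1]`
  set A : ℝ := 4 * 2 ^ d * A₀ with hAdef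
  have hA1 : 1 ≤ A := by
    rw [hAdef]
    exact one_le_mul_of_one_le_of_one_le (one_le_mul_of_one_le_of_one_le (by norm_num) (one_le_pow₀ (by norm_num))) hA₀1
  have hiter := campanato_iteration (ψ := fun t => gradSq u (box z (⌊t⌋ - 1))) (R₀ := 2 * (K : ℝ) + 1) hd hA1 hB0
    (fun t _ _ => gradSq_nonneg _ _) (fun s t _ hst _ => gradSq_mono u (box_mono z (by linarith [Int.floor_le_floor hst])))
    (campanato_hypothesis u z hA₀0 hB0 hstep)
  -- evaluate at `R = 2K+1`, `P = ρ + 1`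
  intro ρ hρ hρK
  have hρR : (0 : ℝ) ≤ ρ := by exact_mod_cast hρ
  have hρKR : (ρ : ℝ) ≤ 2 * K := by exact_mod_cast hρK
  have hmain := hiter ((ρ : ℝ) + 1) (2 * (K : ℝ) + 1) (by linarith) (by linarith) le_rfl
  have eP : ⌊(ρ : ℝ) + 1⌋ - 1 = ρ := by
    rw [show (ρ : ℝ) + 1 = ((ρ + 1 : ℤ) : ℝ) by push_cast; ring, Int.floor_intCast]; ring
  have eR : ⌊2 * (K : ℝ) + 1⌋ - 1 = 2 * (K : ℤ) := by
    rw [show 2 * (K : ℝ) + 1 = ((2 * (K : ℤ) + 1 : ℤ) : ℝ) by push_cast; ring, Int.floor_intCast]; ring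
  simp only [eP, eR] at hmain
  -- the top scale and the inhomogeneity at `R = 2K+1`
  set S : ℝ := Mu + (K : ℝ) * m with hS
  have hS0 : 0 ≤ S := by positivity
  have hMuS : Mu ^ 2 ≤ S ^ 2 := pow_le_pow_left₀ hMu (by rw [hS]; nlinarith) 2
  have hKmS : ((K : ℝ) * m) ^ 2 ≤ S ^ 2 := pow_le_pow_left₀ (by positivity) (by rw [hS]; linarith) 2
  set Q : ℝ := (K : ℝ) ^ d / (K : ℝ) ^ 2 with hQ
  have hQ0 : 0 ≤ Q := by positivity
  have hTop := top_scale_bound hK u g a hEq hu hg hz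
  rw [← hQ] at hTop
  have hBR : B * (2 * (K : ℝ) + 1) ^ d ≤ (4 * A₀ + 2) * d * 15 ^ d * Q * ((K : ℝ) * m) ^ 2 := by
    rw [hB]
    have i1 : (2 * (K : ℝ) + 1) ^ d ≤ 3 ^ d * (K : ℝ) ^ d := by
      rw [← mul_pow]; exact pow_le_pow_left₀ (by positivity) (by linarith) d
    have e : (4 * A₀ + 2) * d * 15 ^ d * Q * ((K : ℝ) * m) ^ 2 = (4 * A₀ + 2) * (d * 5 ^ d * m ^ 2) * ((3 : ℝ) ^ d * (K : ℝ) ^ d) := by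
      rw [hQ, show (15 : ℝ) ^ d = 5 ^ d * 3 ^ d by rw [← mul_pow]; norm_num]
      field_simp
    rw [e]
    exact mul_le_mul_of_nonneg_left i1 (by positivity)
  have hsumTop : gradSq u (box z (2 * K)) + B * (2 * (K : ℝ) + 1) ^ d ≤ (126 * d * 7 ^ d + 4 * d * 6 ^ d + (4 * A₀ + 2) * d * 15 ^ d) * Q * S ^ 2 := by
    have t1 : (126 * d * 7 ^ d) * Q * Mu ^ 2 ≤ (126 * d * 7 ^ d) * Q * S ^ 2 := mul_le_mul_of_nonneg_left hMuS (by positivity)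
    have t2 : (4 * d * 6 ^ d) * Q * ((K : ℝ) * m) ^ 2 ≤ (4 * d * 6 ^ d) * Q * S ^ 2 := mul_le_mul_of_nonneg_left hKmS (by positivity)
    have t3 : (4 * A₀ + 2) * d * 15 ^ d * Q * ((K : ℝ) * m) ^ 2 ≤ (4 * A₀ + 2) * d * 15 ^ d * Q * S ^ 2 := mul_le_mul_of_nonneg_left hKmS (by positivity)
    have e : (126 * d * 7 ^ d + 4 * d * 6 ^ d + (4 * A₀ + 2) * d * 15 ^ d) * Q * S ^ 2 =
        (126 * d * 7 ^ d) * Q * S ^ 2 + (4 * d * 6 ^ d) * Q * S ^ 2 + (4 * A₀ + 2) * d * 15 ^ d * Q * S ^ 2 := by ring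
    rw [e]
    linarith [hTop, hBR]
  -- `((ρ+1)/(2K+1))^{d-1} Q ≤ (ρ+1)^{d-1}/K`
  have hscale : (((ρ : ℝ) + 1) / (2 * (K : ℝ) + 1)) ^ (d - 1) * Q ≤ ((ρ : ℝ) + 1) ^ (d - 1) / K := by
    rw [div_pow]
    have hK1 : (K : ℝ) ^ (d - 1) ≤ (2 * (K : ℝ) + 1) ^ (d - 1) := pow_le_pow_left₀ hK0.le (by linarith) _
    have hQ' : Q = (K : ℝ) ^ (d - 1) / (K : ℝ) := by
      rw [hQ, div_eq_div_iff (by positivity) (ne_of_gt hK0)]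
      have : (K : ℝ) ^ d = (K : ℝ) ^ (d - 1) * K := by rw [← pow_succ]; congr 1; omega
      rw [this]; ring
    rw [hQ', div_mul_div_comm, div_le_div_iff₀ (by positivity) (by positivity)]
    have hρ1 : (0 : ℝ) ≤ ((ρ : ℝ) + 1) ^ (d - 1) := by positivity
    calc ((ρ : ℝ) + 1) ^ (d - 1) * (K : ℝ) ^ (d - 1) * K ≤ ((ρ : ℝ) + 1) ^ (d - 1) * (2 * (K : ℝ) + 1) ^ (d - 1) * K :=
          mul_le_mul_of_nonneg_right (mul_le_mul_of_nonneg_left hK1 hρ1) hK0.le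
      _ = ((ρ : ℝ) + 1) ^ (d - 1) * ((2 * (K : ℝ) + 1) ^ (d - 1) * K) := by ring
  -- finish
  set C₃ : ℝ := 126 * d * 7 ^ d + 4 * d * 6 ^ d + (4 * A₀ + 2) * d * 15 ^ d with hC₃
  have hC₃0 : 0 ≤ C₃ := by positivity
  calc gradSq u (box z ρ)
      ≤ 2 * (2 * A) ^ (2 * (d - 1)) * (((ρ : ℝ) + 1) / (2 * (K : ℝ) + 1)) ^ (d - 1) * (gradSq u (box z (2 * K)) + B * (2 * (K : ℝ) + 1) ^ d) := hmain
    _ ≤ 2 * (2 * A) ^ (2 * (d - 1)) * (((ρ : ℝ) + 1) / (2 * (K : ℝ) + 1)) ^ (d - 1) * (C₃ * Q * S ^ 2) :=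
        mul_le_mul_of_nonneg_left hsumTop (by positivity)
    _ = 2 * (2 * A) ^ (2 * (d - 1)) * C₃ * S ^ 2 * ((((ρ : ℝ) + 1) / (2 * (K : ℝ) + 1)) ^ (d - 1) * Q) := by ring
    _ ≤ 2 * (2 * A) ^ (2 * (d - 1)) * C₃ * S ^ 2 * (((ρ : ℝ) + 1) ^ (d - 1) / K) := mul_le_mul_of_nonneg_left hscale (by positivity)
    _ = 2 * (2 * A) ^ (2 * (d - 1)) * C₃ * S ^ 2 / K * ((ρ : ℝ) + 1) ^ (d - 1) := by ring
    _ = (2 * (2 * (4 * 2 ^ d * A₀)) ^ (2 * (d - 1)) * (126 * d * 7 ^ d + 4 * d * 6 ^ d + (4 * A₀ + 2) * d * 15 ^ d) * (Mu + K * m) ^ 2 / K) *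
          ((ρ : ℝ) + 1) ^ (d - 1) := by
        rw [hAdef, hC₃, hS]

/-! ## §3 The interior `C^{1∕2}` estimate -/

/-- **THE INTERIOR `C^{1∕2}` ESTIMATE ON `ℤ^d`, UNIFORM IN THE SCALE.**  There is `C_d ≥ 0` (depending only on `d ≥ 1`) such that for every `K ≥ 3`, every
`u, g` with `(−Δ + K⁻²)u = ∂*g`, `|u| ≤ M_u`, `|g(·,μ)| ≤ m` on `Q_{4K}(a)`, and every `x′ ∈ Q_{ρ₀}(a)` with `1 ≤ ρ₀ ≤ K`:
`|u(x′) − u(a)| ≤ C_d (M_u + K m) √(ρ₀ ∕ K)` (the Morrey bound at the centres `a` and `x′`, then `abs_sub_le_of_morrey`).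
[folklore] [cite: Giaquinta1984, Ch. III §2 Thm 2.2 p.78, §1 Thm 1.2 p.70; Balaban1984PropagatorsII, (1.9) p.226] -/
theorem exists_interior_holder_const (d : ℕ) (hd : 1 ≤ d) : ∃ C : ℝ, 0 ≤ C ∧
    ∀ (K : ℕ), 3 ≤ K → ∀ (u : Zd d → ℝ) (g : Zd d → Fin d → ℝ) (a : Zd d) (Mu m : ℝ), 0 ≤ Mu → 0 ≤ m →
      (∀ y ∈ box a (4 * K), lop (1 / (K : ℝ) ^ 2) u y = dvg g y) →
      (∀ y ∈ box a (4 * K), |u y| ≤ Mu) → (∀ y ∈ box a (4 * K), ∀ μ, |g y μ| ≤ m) →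
      ∀ (x' : Zd d) (ρ₀ : ℕ), 1 ≤ ρ₀ → ρ₀ ≤ K → x' ∈ box a (ρ₀ : ℤ) →
        |u x' - u a| ≤ C * (Mu + K * m) * Real.sqrt ((ρ₀ : ℝ) / K) := by
  set A₀ : ℝ := (2 : ℝ) ^ d * (1 + 56 * d) ^ d * (8 * ((d : ℝ) + 1)) ^ (d + 1) with hA₀
  set C₄ : ℝ := 2 * (2 * (4 * 2 ^ d * A₀)) ^ (2 * (d - 1)) * (126 * d * 7 ^ d + 4 * d * 6 ^ d + (4 * A₀ + 2) * d * 15 ^ d) with hC₄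
  have hC₄0 : 0 ≤ C₄ := by positivity
  refine ⟨17 * Real.sqrt (16 * d * 8 ^ d) * Real.sqrt (3 * C₄), by positivity, ?_⟩
  intro K hK u g a Mu m hMu hm hEq hu hg x' ρ₀ hρ₀ hρ₀K hx'
  have hK0 : (0 : ℝ) < K := by exact_mod_cast (show 0 < K by omega)
  set S : ℝ := Mu + (K : ℝ) * m with hS
  have hS0 : 0 ≤ S := by positivity
  set N : ℝ := C₄ * S ^ 2 / K with hN
  have hN0 : 0 ≤ N := by positivity
  -- the two centres lie in `Q_K(a)`
  have ha : a ∈ box a (K : ℤ) := self_mem_box a (by positivity)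
  have hx'K : x' ∈ box a (K : ℤ) := box_mono a (by exact_mod_cast hρ₀K) hx'
  have hMa := morrey_bound hd hK u g a hMu hm hEq hu hg ha
  have hMx := morrey_bound hd hK u g a hMu hm hEq hu hg hx'K
  rw [← hA₀] at hMa hMx
  have hMa' : ∀ ρ : ℤ, 0 ≤ ρ → ρ ≤ 2 * (K : ℤ) → gradSq u (box a ρ) ≤ N * ((ρ : ℝ) + 1) ^ (d - 1) := fun ρ h1 h2 => by
    have := hMa ρ h1 h2; rw [hN, hC₄, hS]; exact this
  have hMx' : ∀ ρ : ℤ, 0 ≤ ρ → ρ ≤ 2 * (K : ℤ) → gradSq u (box x' ρ) ≤ N * ((ρ : ℝ) + 1) ^ (d - 1) := fun ρ h1 h2 => by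
    have := hMx ρ h1 h2; rw [hN, hC₄, hS]; exact this
  have hfin := abs_sub_le_of_morrey hd u hρ₀ hx' hN0 (R₀ := 2 * (K : ℤ)) (by linarith) hMa' hMx'
  -- `√(N(2ρ₀+1)) ≤ √(3 C₄) · S · √(ρ₀/K)`
  have hρ₀R : (1 : ℝ) ≤ ρ₀ := by exact_mod_cast hρ₀
  have hkey : Real.sqrt (N * (2 * (ρ₀ : ℝ) + 1)) ≤ Real.sqrt (3 * C₄) * S * Real.sqrt ((ρ₀ : ℝ) / K) := by
    have e : Real.sqrt (3 * C₄ * S ^ 2 * ((ρ₀ : ℝ) / K)) = Real.sqrt (3 * C₄) * S * Real.sqrt ((ρ₀ : ℝ) / K) := by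
      rw [Real.sqrt_mul (by positivity : (0:ℝ) ≤ 3 * C₄ * S ^ 2), Real.sqrt_mul (by positivity : (0:ℝ) ≤ 3 * C₄), Real.sqrt_sq hS0]
    rw [← e]
    apply Real.sqrt_le_sqrt
    rw [hN]
    have h3 : (2 * (ρ₀ : ℝ) + 1) / K ≤ 3 * ((ρ₀ : ℝ) / K) := by
      rw [mul_div_assoc', div_le_div_iff₀ hK0 hK0]; nlinarith
    have h4 : 0 ≤ C₄ * S ^ 2 := by positivity
    calc C₄ * S ^ 2 / K * (2 * (ρ₀ : ℝ) + 1) = C₄ * S ^ 2 * ((2 * (ρ₀ : ℝ) + 1) / K) := by ring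
      _ ≤ C₄ * S ^ 2 * (3 * ((ρ₀ : ℝ) / K)) := mul_le_mul_of_nonneg_left h3 h4
      _ = 3 * C₄ * S ^ 2 * ((ρ₀ : ℝ) / K) := by ring
  calc |u x' - u a| ≤ 17 * Real.sqrt (16 * d * 8 ^ d) * Real.sqrt (N * (2 * (ρ₀ : ℝ) + 1)) := hfin
    _ ≤ 17 * Real.sqrt (16 * d * 8 ^ d) * (Real.sqrt (3 * C₄) * S * Real.sqrt ((ρ₀ : ℝ) / K)) :=
        mul_le_mul_of_nonneg_left hkey (by positivity)
    _ = 17 * Real.sqrt (16 * d * 8 ^ d) * Real.sqrt (3 * C₄) * (Mu + K * m) * Real.sqrt ((ρ₀ : ℝ) / K) := by rw [hS]; ring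

end Literature.MathematicalPhysics.QuantumFieldTheory.Balaban1983to89.B4Eq19LatticeInteriorHolder

end
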